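import Literature.NumberTheory.EllipticCurves.LFunctionSmulProofs
import Literature.NumberTheory.EllipticCurves.QuadraticTwist
import Literature.NumberTheory.EllipticCurves.ShuZhai2021.GeneralizedBirchLemma
import HarnessLib

/-!
# LINE 49 «full_vertex» — the `Q₀ = ∅` slice of stub F0aJ′ is kernel: `C₀ ≅ E₀` has the analytic rank of `E₀`

Crux R″ `RankOneTwoTorsionResidualAtTwo` (stmt-BirchSwinnertonDyer-27478) of route GenusKolyvaginAtTwo, LINE 49
«torsion_cell_full_vertex_bsdidea1» (pen bsd-idea-1), research stub F0aJ′ `FullTorsionSelmerGenericRankLawAtTwo`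
(«for a non-CM analytic-rank-zero base `E₀` in a full base setting and a Selmer-generic genus pair `(C₀, C₁)`:
`r_an(C₀) = 0`», the 2-CONVERSE on the generic full cell; beyond print for `Q₀ ≠ ∅`).  At `Q₀ = ∅` the genus pair is
`(C₀, C₁) = (T₀ • E₀^{(1)}, T₁ • E₀^{(−p₀)})` (`M₀ = ∏_{q ∈ ∅} q* = 1`), and `E₀^{(1)} = C • E₀` is a MODEL of `E₀`
(`exists_variableChange_quadraticTwist_one`); the analytic rank is a model invariant (`analyticRank_smul`), so the
conclusion `r_an(C₀) = 0` IS the hypothesis `r_an(E₀) = 0`: the slice holds with every other binder of F0aJ′ (non-CM,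
`FullBaseSetting`, Selmer-genericity) dropped.  (The companion stub F0bJ at `Q₀ = ∅` reads «`BSD₂(E₀) ⟹
v₂ #Ш_an(E₀) + v₂ #Ш_an(E₀^{(−p₀)}) = 0`», i.e. the `2`-part of BSD for the Heegner-prime twist `E₀^{(−p₀)}` — NOT kernel,
and not claimed here.)  As for the landed D0≤2 closer (`…TorsionCellD0Closer`, `#Q₀ = 0` via `E₀^{(1)} ≅ E₀`), the LINE's
defs are not importable from `Theorems`, so the slice is stated on the UNFOLDED first conjunct of `IsGenusPair E₀ p₀ ∅ C₀ C₁`.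

Everything is proved (no `sorry`, standard axioms); F0aJ′ itself stays OPEN (research); NOTHING HERE PROVES R″ or any summit.

## References

* [SilvermanAEC2009] J. H. Silverman, *The Arithmetic of Elliptic Curves*, App. C §16 (the `L`-function is an
  isomorphism invariant).
* [ShuZhai2021] J. Shu, S. Zhai, arXiv:2102.11808, §1 (`q*`, `M = ∏ q*`).
-/

namespace Summit.BirchSwinnertonDyer.BirchSwinnertonDyer.Theorems.GenusKolyvaginAtTwo.FullVertex

open WeierstrassCurve Literature.NumberTheory.EllipticCurves.ShuZhai2021

/-- A model of the trivial twist `E₀^{(M₀)}`, `M₀ = ∏_{q ∈ ∅} q* = 1`, has the analytic rank of `E₀`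
(`E₀^{(1)} = C • E₀`, and `r_an` is a model invariant). [cite: SilvermanAEC2009, App. C §16] -/
theorem analyticRank_eq_of_smul_quadraticTwist_prod_empty (E₀ C₀ : WeierstrassCurve ℚ) [E₀.IsElliptic] [C₀.IsElliptic]
    (hC₀ : ∃ T : VariableChange ℚ, T • E₀.quadraticTwist ((∏ q ∈ (∅ : Finset ℕ), qStar q : ℤ) : ℚ) = C₀) :
    C₀.analyticRank = E₀.analyticRank := by
  obtain ⟨T, hT⟩ := hC₀
  rw [Finset.prod_empty, Int.cast_one] at hT
  obtain ⟨C, hC⟩ := E₀.exists_variableChange_quadraticTwist_one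
  rw [← hC, ← mul_smul] at hT
  subst hT
  exact analyticRank_smul E₀ (T * C)

/-- **F0aJ′ at `Q₀ = ∅` (kernel slice).**  For ANY base `E₀` of analytic rank `0` and any model `C₀` of `E₀^{(M₀)}` with
`M₀ = ∏_{q ∈ ∅} q* = 1` — the first conjunct of LINE 49's `IsGenusPair E₀ p₀ ∅ C₀ C₁`, unfolded — `r_an(C₀) = 0`.  This is the
`Q₀ = ∅` instance of the stub `FullTorsionSelmerGenericRankLawAtTwo` with its other binders (non-CM, `FullBaseSetting`,
Selmer-genericity) unused; the stub for `Q₀ ≠ ∅` is untouched. [cite: SilvermanAEC2009, App. C §16] [cite: ShuZhai2021, §1] -/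
theorem fullTorsionSelmerGenericRankLawAtTwo_empty (E₀ C₀ : WeierstrassCurve ℚ) [E₀.IsElliptic] [C₀.IsElliptic]
    (hE₀ : E₀.analyticRank = 0)
    (hC₀ : ∃ T : VariableChange ℚ, T • E₀.quadraticTwist ((∏ q ∈ (∅ : Finset ℕ), qStar q : ℤ) : ℚ) = C₀) :
    C₀.analyticRank = 0 := by
  rw [analyticRank_eq_of_smul_quadraticTwist_prod_empty E₀ C₀ hC₀, hE₀]

/-- The same transport for the trivial twist read with an EXPLICIT parameter `1` (no product): a model of `E₀^{(1)}` has
the analytic rank of `E₀`. [cite: SilvermanAEC2009, App. C §16] -/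
theorem analyticRank_eq_of_smul_quadraticTwist_one (E₀ C₀ : WeierstrassCurve ℚ) [E₀.IsElliptic] [C₀.IsElliptic]
    (hC₀ : ∃ T : VariableChange ℚ, T • E₀.quadraticTwist 1 = C₀) : C₀.analyticRank = E₀.analyticRank := by
  obtain ⟨T, hT⟩ := hC₀
  obtain ⟨C, hC⟩ := E₀.exists_variableChange_quadraticTwist_one
  rw [← hC, ← mul_smul] at hT
  subst hT
  exact analyticRank_smul E₀ (T * C)

end Summit.BirchSwinnertonDyer.BirchSwinnertonDyer.Theorems.GenusKolyvaginAtTwo.FullVertex
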